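/-
Copyright (c) 2026. All rights reserved.
Released under Apache 2.0 license as described in the file LICENSE.
Authors: abc-iut cell, seat abc-iut-L4-t10 (gen 2; row C45-M0 of plan/L4/SUBDAG-AbsTopIII-Cor45.md:
the MODEL of [AbsTopIII] Cor 4.5 — Def 4.1 (iii) at category level, part 2/3).
-/
import Literature.AnabelianGeometry.AbsoluteAnabelian.ArchimedeanHolCategories
import HarnessLib

/-!
# [AbsTopIII] Def 4.1 (iii): the categories `𝒞^hol_TF` and `𝒞^hol_TH` as Mathlib categories

S. Mochizuki, *Topics in absolute anabelian geometry III*, §4, Def 4.1 (i)–(iii) pp. 101–103, Prop 4.2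
(i) p. 105, Def 4.1 (v) p. 105, kurims manuscript (lit key `paper:url-5493eb38cbb7`, read on the page;
bib key `MochizukiAbsTopIII2015`).  Part 2/3 of the MODEL of Cor 4.5 (cell sub-DAG row C45-M0), over the
interface `𝔄 : AutHolFieldFunctor` of `ArchimedeanHolCategories.lean` (Cor 2.7 (e) + functoriality; see
that file's docstring for the framing).  Built here (REAL categories; `T = TF`):

* `HolTFPair 𝔄` + category: **`𝒳 = 𝒞^hol_TF`** — objects `(𝕏 ↶^κ k)`: `𝕏 ∈ Ob(EA)`, a CAF `k`, Kummer
  structure an isomorphism of topological fields `κ : k ⥲ 𝒜_𝕏` (Def 4.1 (i)(ii): a `TF`-pair is isomorphic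
  to a model pair whose Kummer structure is a `k`-Kummer structure `κ_k : k ⥲ 𝒜_𝕏_ell`, so for `T = TF`
  every Kummer structure IS such an isomorphism); morphisms `(φ_𝕏, φ_M)` — "a morphism of objects
  `φ_M : M₁ → M₂` of `T` [continuous field homomorphism], together with a compatible [relative to the
  respective Kummer structures] finite étale morphism `φ_𝕏 : 𝕏₁ → 𝕏₂`", compatibility
  `κ₂ ∘ φ_M = 𝒜_{φ_𝕏} ∘ κ₁` with the INDUCED `𝒜_{φ_𝕏}`.  PROVED: `φ_M` is determined by `φ_𝕏`
  (`Hom.ext_of_base`) and every `φ_𝕏` lifts (`Hom.ofBase`), so `Hom_𝒳 ≃ Hom_EA` (`homEquivBase`) — the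
  content of Prop 4.2 (i) ("induces a bijection") at this model; hence also `𝒞^hol_TF = 𝒞̲^hol_TF` (every
  morphism is a `T`-isomorphism), the version `𝒳 := 𝒞^hol_T = 𝒞̲^hol_T` of Cor 4.5.
* `HolTHPair 𝔄` + category: **`𝒩 = 𝒞^hol_TH`** for arithmetic data PRESENTED INSIDE A CAF — objects
  `(𝕏 ↶^κ M)`, `M` "the Aut-holomorphic space determined by" a connected open subspace of a CAF `k` (Def
  4.1 (iv): `k^×`, `k~`, `(k~)^×`), Kummer structure "the co-holomorphicization determined by" an
  isomorphism of topological fields `c : k ⥲ 𝒜_𝕏` (Def 4.1 (i)/(iv)); morphisms `(φ_𝕏, φ_M)` with `φ_M` a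
  holomorphic local isomorphism in the Kummer charts (`IsHolLocIso` of part 1: read in `ℂ` through
  `c₁, 𝒜_{φ_𝕏}` and `c₂`, for EVERY `𝒜_𝕐 ⥲ ℂ` — both charts change together, so the choice is immaterial)
  = print's "morphism of Aut-holomorphic spaces compatible with the Kummer structures" via Prop 2.2 (i)
  / Cor 2.3 (i) (Aut-holomorphic morphisms of Riemann surfaces are the RC-holomorphic local
  isomorphisms; the co-holomorphicization class singles out the holomorphic ones).
  -- TODO(general form): arbitrary connected Aut-holomorphic orbispaces as arithmetic data of type `TH`
  -- (Def 4.1 (i)); Cor 4.5 only meets objects in the image of `λ^×`, `λ^∼`, all of the present kind.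
* functors: `(𝕏 ↶ M) ↦ 𝕏` (`HolTFPair.toEA`, `HolTHPair.toEA`, Def 4.1 (iii)); `𝕏 ↦ (𝕏 ↶ 𝒜_𝕏)` with the
  tautological Kummer structure (`HolTFPair.ofEA`, Def 4.1 (v) / the `φ_LH` of Cor 4.5 (ii) read on `EA`)
  and the two halves `toOfEA` / `ofOfEA` of the isomorphisms `η_LH` (Cor 4.5 (ii)).

Refereed pre-IUT anabelian geometry; a MODEL (kernel definitions) over a named interface; nothing here
bears on [IUTchIII] Cor. 3.12; typed ≠ discharged.
-/

set_option autoImplicit false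

noncomputable section

namespace Literature.AnabelianGeometry.AbsoluteAnabelian

open _root_.CategoryTheory _root_.Topology

universe u

/-! ### `𝒳 = 𝒞^hol_TF`: Aut-holomorphic `TF`-pairs -/

/-- **An object of `𝒞^hol_TF`** (Def 4.1 (ii)(iii)): an Aut-holomorphic `TF`-pair `(𝕏 ↶^κ k)` —
structure-orbispace `𝕏 ∈ Ob(EA)`, arithmetic data a CAF `k` (an object of `TF` isomorphic to the model
datum "the object determined by `k`", Def 4.1 (i)), and Kummer structure an isomorphism of topological
fields `κ : k ⥲ 𝒜_𝕏` (Def 4.1 (i): "a [k-]Kummer structure on `𝕏_ell` [is] any isomorphism of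
topological fields `κ_k : k ⥲ 𝒜_𝕏_ell`"; a `TF`-pair is isomorphic to such a model, Def 4.1 (ii) (c), so
its Kummer structure is again such an isomorphism).
[cite: MochizukiAbsTopIII2015, Definition 4.1 (ii) p.102] -/
structure HolTFPair (𝔄 : AutHolFieldFunctor.{u}) : Type (u + 1) where
  /-- The structure-orbispace `𝕏`. -/
  X : 𝔄.EA
  /-- The arithmetic data, a CAF `k`. -/
  k : Type u
  [normedField : NormedField k]
  isCAF : IsCAF k
  /-- The Kummer structure `κ : k ⥲ 𝒜_𝕏`, an isomorphism of topological fields. -/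
  κ : k ≃+* 𝔄.A X
  continuous_κ : Continuous κ
  continuous_κ_symm : Continuous κ.symm

attribute [instance] HolTFPair.normedField

namespace HolTFPair

variable {𝔄 : AutHolFieldFunctor.{u}}

/-- The arithmetic data of a `TF`-pair has characteristic zero (a CAF). [cite: MochizukiAbsTopIII2015, Definition 4.1 (i) p.101] -/
theorem charZero_k (P : HolTFPair 𝔄) : CharZero P.k := P.isCAF.charZero

/-- **A morphism of Aut-holomorphic `TF`-pairs** `(𝕏₁ ↶ k₁) → (𝕏₂ ↶ k₂)` (Def 4.1 (ii)): "a morphism of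
objects `φ_M : M₁ → M₂` of `T`" — a continuous field homomorphism — "together with a compatible
[relative to the respective Kummer structures] finite étale morphism `φ_𝕏 : 𝕏₁ → 𝕏₂`": compatibility
`κ₂ (φ_M m) = 𝒜_{φ_𝕏} (κ₁ m)` with the isomorphism `𝒜_{φ_𝕏}` INDUCED by `φ_𝕏` (Cor 2.7 functoriality).
[cite: MochizukiAbsTopIII2015, Definition 4.1 (ii) p.102] -/
@[ext]
structure Hom (P Q : HolTFPair 𝔄) : Type (u + 1) where
  /-- `φ_𝕏`, a finite étale morphism of `EA`. -/
  base : P.X ⟶ Q.X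
  /-- `φ_M`, a continuous field homomorphism. -/
  arith : P.k →+* Q.k
  continuous_arith : Continuous arith
  /-- Compatibility with the Kummer structures. -/
  compat : ∀ m : P.k, Q.κ (arith m) = 𝔄.Amap base (P.κ m)

/-- The identity morphism of a pair. [cite: MochizukiAbsTopIII2015, Definition 4.1 (ii) p.102] -/
protected def Hom.id (P : HolTFPair 𝔄) : Hom P P where
  base := 𝟙 P.X
  arith := RingHom.id P.k
  continuous_arith := continuous_id
  compat m := by rw [𝔄.Amap_id_apply]; rfl

/-- Composition of morphisms of pairs. [cite: MochizukiAbsTopIII2015, Definition 4.1 (ii) p.102] -/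
protected def Hom.comp {P Q R : HolTFPair 𝔄} (φ : Hom P Q) (ψ : Hom Q R) : Hom P R where
  base := φ.base ≫ ψ.base
  arith := ψ.arith.comp φ.arith
  continuous_arith := ψ.continuous_arith.comp φ.continuous_arith
  compat m := by
    rw [𝔄.Amap_comp_apply, RingHom.comp_apply, ψ.compat, φ.compat]

/-- **`𝒞^hol_TF` is a category** ("the category whose objects are the Aut-holomorphic `T`-pairs and whose
morphisms are the morphisms of Aut-holomorphic `T`-pairs", Def 4.1 (iii)).
[cite: MochizukiAbsTopIII2015, Definition 4.1 (iii) pp.102–103] -/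
instance category : Category.{u + 1} (HolTFPair 𝔄) where
  Hom := Hom
  id := Hom.id
  comp := Hom.comp
  id_comp φ := by apply Hom.ext <;> simp [Hom.id, Hom.comp]
  comp_id φ := by apply Hom.ext <;> simp [Hom.id, Hom.comp]
  assoc φ ψ χ := by apply Hom.ext <;> simp [Hom.comp, RingHom.comp_assoc]

/-- The structure part of an identity is the identity. [cite: MochizukiAbsTopIII2015, Definition 4.1 (ii) p.102] -/
@[simp] theorem id_base (P : HolTFPair 𝔄) : (𝟙 P : Hom P P).base = 𝟙 P.X := rfl
/-- The arithmetic part of an identity is the identity. [cite: MochizukiAbsTopIII2015, Definition 4.1 (ii) p.102] -/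
@[simp] theorem id_arith_apply (P : HolTFPair 𝔄) (m : P.k) : (𝟙 P : Hom P P).arith m = m := rfl
/-- The structure part of a composite is the composite. [cite: MochizukiAbsTopIII2015, Definition 4.1 (ii) p.102] -/
@[simp] theorem comp_base {P Q R : HolTFPair 𝔄} (φ : P ⟶ Q) (ψ : Q ⟶ R) :
    (φ ≫ ψ).base = φ.base ≫ ψ.base := rfl
/-- The arithmetic part of a composite is the composite. [cite: MochizukiAbsTopIII2015, Definition 4.1 (ii) p.102] -/
@[simp] theorem comp_arith_apply {P Q R : HolTFPair 𝔄} (φ : P ⟶ Q) (ψ : Q ⟶ R) (m : P.k) :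
    (φ ≫ ψ).arith m = ψ.arith (φ.arith m) := rfl

/-- The arithmetic part of a morphism is DETERMINED by its structure part: `φ_M = κ₂⁻¹ ∘ 𝒜_{φ_𝕏} ∘ κ₁`
(the Kummer structures are isomorphisms). [cite: MochizukiAbsTopIII2015, Definition 4.1 (ii) p.102] -/
theorem Hom.arith_apply {P Q : HolTFPair 𝔄} (φ : P ⟶ Q) (m : P.k) :
    φ.arith m = Q.κ.symm (𝔄.Amap φ.base (P.κ m)) := by
  rw [← φ.compat, RingEquiv.symm_apply_apply]

/-- Two morphisms of pairs with the same structure part are equal.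
[cite: MochizukiAbsTopIII2015, Definition 4.1 (ii) p.102] -/
theorem Hom.ext_of_base {P Q : HolTFPair 𝔄} {φ ψ : P ⟶ Q} (h : φ.base = ψ.base) : φ = ψ := by
  apply Hom.ext h
  ext m
  rw [Hom.arith_apply, Hom.arith_apply, h]

/-- **Every finite étale `φ_𝕏 : 𝕏 → 𝕐` lifts to a morphism of pairs** `(𝕏 ↶ k) → (𝕐 ↶ k')`, with
arithmetic part `κ'⁻¹ ∘ 𝒜_{φ_𝕏} ∘ κ` (the proof of Prop 4.2 (i): "immediate from the required compatibility
of morphisms of `𝒞^hol_T` with the Kummer structures").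
[cite: MochizukiAbsTopIII2015, Proposition 4.2 (i) p.105] -/
def Hom.ofBase (P Q : HolTFPair 𝔄) (f : P.X ⟶ Q.X) : P ⟶ Q where
  base := f
  arith := ((P.κ.trans (𝔄.Amap f)).trans Q.κ.symm).toRingHom
  continuous_arith := Q.continuous_κ_symm.comp ((𝔄.continuous_Amap f).comp P.continuous_κ)
  compat m := by
    change Q.κ (Q.κ.symm (𝔄.Amap f (P.κ m))) = _
    rw [RingEquiv.apply_symm_apply]

/-- The lift of `φ_𝕏` has structure part `φ_𝕏`. [cite: MochizukiAbsTopIII2015, Proposition 4.2 (i) p.105] -/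
@[simp] theorem Hom.ofBase_base (P Q : HolTFPair 𝔄) (f : P.X ⟶ Q.X) : (Hom.ofBase P Q f).base = f := rfl

/-- **Prop 4.2 (i) at the model, morphism level**: `(𝕏 ↶ k) ⟶ (𝕐 ↶ k')` in `𝒞^hol_TF` are in bijection
with the finite étale `𝕏 ⟶ 𝕐` via `(φ_𝕏, φ_M) ↦ φ_𝕏`.
[cite: MochizukiAbsTopIII2015, Proposition 4.2 (i) p.105] -/
def homEquivBase (P Q : HolTFPair 𝔄) : (P ⟶ Q) ≃ (P.X ⟶ Q.X) where
  toFun φ := φ.base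
  invFun f := Hom.ofBase P Q f
  left_inv _ := Hom.ext_of_base rfl
  right_inv _ := rfl

variable (𝔄) in
/-- **Def 4.1 (iii): the natural functor `𝒞^hol_TF → EA`**, "the assignment `(𝕏 ↶ M) ↦ 𝕏`".
[cite: MochizukiAbsTopIII2015, Definition 4.1 (iii) p.103] -/
def toEA : HolTFPair 𝔄 ⥤ 𝔄.EA where
  obj P := P.X
  map φ := φ.base

/-- `(𝕏 ↶ k) ↦ 𝕏` on objects. [cite: MochizukiAbsTopIII2015, Definition 4.1 (iii) p.103] -/
@[simp] theorem toEA_obj (P : HolTFPair 𝔄) : (toEA 𝔄).obj P = P.X := rfl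
/-- `(φ_𝕏, φ_M) ↦ φ_𝕏` on morphisms. [cite: MochizukiAbsTopIII2015, Definition 4.1 (iii) p.103] -/
@[simp] theorem toEA_map {P Q : HolTFPair 𝔄} (φ : P ⟶ Q) : (toEA 𝔄).map φ = φ.base := rfl

variable (𝔄) in
/-- **The pair `(𝕏 ↶ 𝒜_𝕏)` with the tautological Kummer structure**, functorially in `𝕏 ∈ Ob(EA)`: on a
finite étale `φ` the arithmetic part is the induced `𝒜_φ` (Def 4.1 (v): "the tautological Kummer map
`𝒜_𝕏 ⥲ 𝒜_𝕏` [i.e., given by the identity on the object of `TF` determined by `𝒜_𝕏`]"; Cor 4.5 (ii): the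
forgetful functor `φ_LH`, `(𝕏, 𝕏 ↶ 𝒜_𝕏) ↦ (𝕏 ↶ 𝒜_𝕏)`).
[cite: MochizukiAbsTopIII2015, Definition 4.1 (v) p.105] -/
def ofEA : 𝔄.EA ⥤ HolTFPair 𝔄 where
  obj X :=
    { X := X, k := 𝔄.A X, isCAF := 𝔄.isCAF X, κ := RingEquiv.refl _, continuous_κ := continuous_id,
      continuous_κ_symm := continuous_id }
  map f :=
    { base := f, arith := (𝔄.Amap f).toRingHom, continuous_arith := 𝔄.continuous_Amap f,
      compat := fun _ => rfl }
  map_id X := by apply Hom.ext_of_base; rfl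
  map_comp f g := by apply Hom.ext_of_base; rfl

/-- The structure-orbispace of `(𝕏 ↶ 𝒜_𝕏)` is `𝕏`. [cite: MochizukiAbsTopIII2015, Definition 4.1 (v) p.105] -/
@[simp] theorem ofEA_obj_X (X : 𝔄.EA) : ((ofEA 𝔄).obj X).X = X := rfl
/-- The arithmetic data of `(𝕏 ↶ 𝒜_𝕏)` is `𝒜_𝕏`. [cite: MochizukiAbsTopIII2015, Definition 4.1 (v) p.105] -/
@[simp] theorem ofEA_obj_k (X : 𝔄.EA) : ((ofEA 𝔄).obj X).k = 𝔄.A X := rfl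
/-- The Kummer structure of `(𝕏 ↶ 𝒜_𝕏)` is tautological. [cite: MochizukiAbsTopIII2015, Definition 4.1 (v) p.105] -/
@[simp] theorem ofEA_obj_κ_apply (X : 𝔄.EA) (a : 𝔄.A X) : ((ofEA 𝔄).obj X).κ a = a := rfl
/-- `ofEA` on morphisms: structure part. [cite: MochizukiAbsTopIII2015, Definition 4.1 (v) p.105] -/
@[simp] theorem ofEA_map_base {X Y : 𝔄.EA} (f : X ⟶ Y) : ((ofEA 𝔄).map f).base = f := rfl
/-- `ofEA` on morphisms: arithmetic part is the induced `𝒜_φ`. [cite: MochizukiAbsTopIII2015, Definition 4.1 (v) p.105] -/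
@[simp] theorem ofEA_map_arith_apply {X Y : 𝔄.EA} (f : X ⟶ Y) (a : 𝔄.A X) :
    ((ofEA 𝔄).map f).arith a = 𝔄.Amap f a := rfl

/-- `(𝕏 ↶ 𝒜_𝕏) ↦ 𝕏` is the identity: `ofEA ⋙ toEA = 𝟭`. [cite: MochizukiAbsTopIII2015, Definition 4.1 (v) p.105] -/
theorem ofEA_comp_toEA : ofEA 𝔄 ⋙ toEA 𝔄 = 𝟭 𝔄.EA := rfl

/-- The canonical isomorphism `(𝕏 ↶ k) ⥲ (𝕏 ↶ 𝒜_𝕏)` given by the Kummer structure `κ` itself (the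
inverse of the component of `η_LH`, Cor 4.5 (ii)). [cite: MochizukiAbsTopIII2015, Corollary 4.5 (ii) p.108] -/
def toOfEA (P : HolTFPair 𝔄) : P ⟶ (ofEA 𝔄).obj P.X where
  base := 𝟙 P.X
  arith := P.κ.toRingHom
  continuous_arith := P.continuous_κ
  compat m := by
    change (P.κ m : 𝔄.A P.X) = 𝔄.Amap (𝟙 P.X) (P.κ m)
    rw [𝔄.Amap_id_apply]

/-- … and its inverse `(𝕏 ↶ 𝒜_𝕏) ⥲ (𝕏 ↶ k)` given by `κ⁻¹` (the component of `η_LH`).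
[cite: MochizukiAbsTopIII2015, Corollary 4.5 (ii) p.108] -/
def ofOfEA (P : HolTFPair 𝔄) : (ofEA 𝔄).obj P.X ⟶ P where
  base := 𝟙 P.X
  arith := P.κ.symm.toRingHom
  continuous_arith := P.continuous_κ_symm
  compat m := by
    change P.κ (P.κ.symm m) = 𝔄.Amap (𝟙 P.X) m
    rw [𝔄.Amap_id_apply, RingEquiv.apply_symm_apply]

/-- Structure part of `(𝕏 ↶ k) → (𝕏 ↶ 𝒜_𝕏)`. [cite: MochizukiAbsTopIII2015, Corollary 4.5 (ii) p.108] -/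
@[simp] theorem toOfEA_base (P : HolTFPair 𝔄) : (toOfEA P).base = 𝟙 P.X := rfl
/-- Structure part of `(𝕏 ↶ 𝒜_𝕏) → (𝕏 ↶ k)`. [cite: MochizukiAbsTopIII2015, Corollary 4.5 (ii) p.108] -/
@[simp] theorem ofOfEA_base (P : HolTFPair 𝔄) : (ofOfEA P).base = 𝟙 P.X := rfl
/-- Arithmetic part of `(𝕏 ↶ k) → (𝕏 ↶ 𝒜_𝕏)` is `κ`. [cite: MochizukiAbsTopIII2015, Corollary 4.5 (ii) p.108] -/
@[simp] theorem toOfEA_arith_apply (P : HolTFPair 𝔄) (m : P.k) : (toOfEA P).arith m = P.κ m := rfl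
/-- Arithmetic part of `(𝕏 ↶ 𝒜_𝕏) → (𝕏 ↶ k)` is `κ⁻¹`. [cite: MochizukiAbsTopIII2015, Corollary 4.5 (ii) p.108] -/
@[simp] theorem ofOfEA_arith_apply (P : HolTFPair 𝔄) (a : 𝔄.A P.X) :
    (ofOfEA P).arith a = P.κ.symm a := rfl

end HolTFPair

/-! ### `𝒩 = 𝒞^hol_TH`: `TH`-pairs with arithmetic data presented inside a CAF -/

/-- **An object of `𝒞^hol_TH`** whose arithmetic data is presented inside a CAF (Def 4.1 (i)(ii)(iv)):
structure-orbispace `𝕏 ∈ Ob(EA)`; arithmetic data "the Aut-holomorphic space determined by" a connected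
open subspace `M` of a CAF `k` (`k^×`, `k~`, `(k~)^×` in Def 4.1 (iv)); Kummer structure the
co-holomorphicization `M → 𝒜_𝕏` "determined by" an isomorphism of topological fields `c : k ⥲ 𝒜_𝕏`
(Def 4.1 (i): "`κ_k` determines co-holomorphicizations between `k` and `𝒜_𝕏_ell`, as well as between
`k~` and `𝒜_𝕏_ell`").  See the module docstring for the restriction to sub-CAF arithmetic data.
[cite: MochizukiAbsTopIII2015, Definition 4.1 (ii) p.102] -/
structure HolTHPair (𝔄 : AutHolFieldFunctor.{u}) : Type (u + 1) where
  /-- The structure-orbispace `𝕏`. -/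
  X : 𝔄.EA
  /-- The ambient CAF. -/
  k : Type u
  [normedField : NormedField k]
  isCAF : IsCAF k
  /-- The arithmetic data: a connected open subspace of `k`. -/
  carrier : Set k
  isOpen_carrier : IsOpen carrier
  isConnected_carrier : IsConnected carrier
  /-- The field isomorphism determining the Kummer structure (a co-holomorphicization). -/
  c : k ≃+* 𝔄.A X
  continuous_c : Continuous c
  continuous_c_symm : Continuous c.symm

attribute [instance] HolTHPair.normedField

namespace HolTHPair

variable {𝔄 : AutHolFieldFunctor.{u}}

/-- The ambient CAF of a `TH`-pair has characteristic zero. [cite: MochizukiAbsTopIII2015, Definition 4.1 (i) p.101] -/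
theorem charZero_k (P : HolTHPair 𝔄) : CharZero P.k := P.isCAF.charZero

/-- The chart `k → ℂ` of a pair read through a field isomorphism `e : 𝒜_𝕐 ⥲ ℂ` and a finite étale
`φ_𝕏 : 𝕏 → 𝕐`: `e ∘ 𝒜_{φ_𝕏} ∘ c`. [cite: MochizukiAbsTopIII2015, Definition 4.1 (ii) p.102] -/
def chart (P : HolTHPair 𝔄) {Y : 𝔄.EA} (f : P.X ⟶ Y) (e : 𝔄.A Y ≃+* ℂ) : P.k → ℂ :=
  fun x => e (𝔄.Amap f (P.c x))

/-- Charts are injective. [cite: MochizukiAbsTopIII2015, Definition 4.1 (ii) p.102] -/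
theorem chart_injective (P : HolTHPair 𝔄) {Y : 𝔄.EA} (f : P.X ⟶ Y) (e : 𝔄.A Y ≃+* ℂ) :
    Function.Injective (P.chart f e) :=
  e.injective.comp ((𝔄.Amap f).injective.comp P.c.injective)

/-- The chart image of the (open) arithmetic datum is open in `ℂ`. [cite: MochizukiAbsTopIII2015, Definition 4.1 (ii) p.102] -/
theorem isOpen_chart_image (P : HolTHPair 𝔄) {Y : 𝔄.EA} (f : P.X ⟶ Y) (e : 𝔄.A Y ≃+* ℂ)
    (he : Continuous e) (he' : Continuous e.symm) : IsOpen (P.chart f e '' P.carrier) := by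
  have h : IsOpenMap (P.chart f e) :=
    (ringEquivHomeomorph e he he').isOpenMap.comp
      ((ringEquivHomeomorph _ (𝔄.continuous_Amap f) (𝔄.continuous_Amap_symm f)).isOpenMap.comp
        (ringEquivHomeomorph _ P.continuous_c P.continuous_c_symm).isOpenMap)
  exact h _ P.isOpen_carrier

/-- The chart through the identity is `e ∘ c`. [cite: MochizukiAbsTopIII2015, Definition 4.1 (ii) p.102] -/
@[simp] theorem chart_id_apply (P : HolTHPair 𝔄) (e : 𝔄.A P.X ≃+* ℂ) (x : P.k) :
    P.chart (𝟙 P.X) e x = e (P.c x) := by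
  simp [chart]

/-- The chart through a composite `φ ≫ ψ` is the chart through `φ` read via `𝒜_ψ`. [cite: MochizukiAbsTopIII2015, Definition 4.1 (ii) p.102] -/
theorem chart_comp_apply (P : HolTHPair 𝔄) {Y Z : 𝔄.EA} (f : P.X ⟶ Y) (g : Y ⟶ Z) (e : 𝔄.A Z ≃+* ℂ)
    (x : P.k) : P.chart (f ≫ g) e x = P.chart f ((𝔄.Amap g).trans e) x := by
  simp [chart]

/-- **A morphism of `𝒞^hol_TH`** `(𝕏₁ ↶ M₁) → (𝕏₂ ↶ M₂)` (Def 4.1 (ii)): a finite étale `φ_𝕏 : 𝕏₁ → 𝕏₂`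
together with a map `φ_M : M₁ → M₂` which is a holomorphic local isomorphism when `M₁ ⊆ k₁` is read in
`ℂ` through `c₁` followed by `𝒜_{φ_𝕏}` and `M₂ ⊆ k₂` through `c₂` — for EVERY isomorphism of topological
fields `𝒜_𝕏₂ ⥲ ℂ` (= "a morphism of objects of `TH` … compatible [relative to the respective Kummer
structures]", the Kummer structures being the co-holomorphicizations determined by `c₁`, `c₂`).
[cite: MochizukiAbsTopIII2015, Definition 4.1 (ii) p.102] -/
@[ext]
structure Hom (P Q : HolTHPair 𝔄) : Type (u + 1) where
  /-- `φ_𝕏`, a finite étale morphism of `EA`. -/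
  base : P.X ⟶ Q.X
  /-- `φ_M` on the arithmetic datum. -/
  toFun : P.carrier → Q.k
  mem : ∀ x, toFun x ∈ Q.carrier
  /-- Compatibility with the co-holomorphicizations: holomorphic local isomorphism in the charts. -/
  hol : ∀ (e : 𝔄.A Q.X ≃+* ℂ), Continuous e → Continuous e.symm →
    IsHolLocIso (P.chart base e) (Q.chart (𝟙 Q.X) e) P.carrier toFun

/-- The identity morphism. [cite: MochizukiAbsTopIII2015, Definition 4.1 (ii) p.102] -/
protected def Hom.id (P : HolTHPair 𝔄) : Hom P P where
  base := 𝟙 P.X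
  toFun x := x
  mem x := x.2
  hol e he he' :=
    IsHolLocIso.of_eq_id (P.chart_injective _ e) (P.isOpen_chart_image _ e he he') (fun _ => rfl)

/-- Composition of morphisms. [cite: MochizukiAbsTopIII2015, Definition 4.1 (ii) p.102] -/
protected def Hom.comp {P Q R : HolTHPair 𝔄} (φ : Hom P Q) (ψ : Hom Q R) : Hom P R where
  base := φ.base ≫ ψ.base
  toFun x := ψ.toFun ⟨φ.toFun x, φ.mem x⟩
  mem x := ψ.mem _
  hol e he he' := by
    have hφ := φ.hol ((𝔄.Amap ψ.base).trans e) (he.comp (𝔄.continuous_Amap _))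
      ((𝔄.continuous_Amap_symm _).comp he')
    have hψ := ψ.hol e he he'
    have h1 : P.chart (φ.base ≫ ψ.base) e = P.chart φ.base ((𝔄.Amap ψ.base).trans e) :=
      funext fun x => P.chart_comp_apply _ _ e x
    have h2 : Q.chart (𝟙 Q.X) ((𝔄.Amap ψ.base).trans e) = Q.chart ψ.base e :=
      funext fun x => by simp [chart]
    rw [h1]
    rw [h2] at hφ
    exact IsHolLocIso.comp (P.chart_injective _ _) (Q.chart_injective _ _)
      (by rw [← h1]; exact P.isOpen_chart_image _ e he he') (Q.isOpen_chart_image _ e he he') hφ hψ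
      φ.mem

/-- **`𝒞^hol_TH` is a category** (Def 4.1 (iii)). [cite: MochizukiAbsTopIII2015, Definition 4.1 (iii) pp.102–103] -/
instance category : Category.{u + 1} (HolTHPair 𝔄) where
  Hom := Hom
  id := Hom.id
  comp := Hom.comp
  id_comp φ := by apply Hom.ext <;> simp [Hom.id, Hom.comp]
  comp_id φ := by apply Hom.ext <;> simp [Hom.id, Hom.comp]
  assoc φ ψ χ := by apply Hom.ext <;> simp [Hom.comp]

/-- The structure part of an identity is the identity. [cite: MochizukiAbsTopIII2015, Definition 4.1 (ii) p.102] -/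
@[simp] theorem id_base (P : HolTHPair 𝔄) : (𝟙 P : Hom P P).base = 𝟙 P.X := rfl
/-- The arithmetic part of an identity is the identity map. [cite: MochizukiAbsTopIII2015, Definition 4.1 (ii) p.102] -/
@[simp] theorem id_toFun (P : HolTHPair 𝔄) (x : P.carrier) : (𝟙 P : Hom P P).toFun x = x := rfl
/-- The structure part of a composite is the composite. [cite: MochizukiAbsTopIII2015, Definition 4.1 (ii) p.102] -/
@[simp] theorem comp_base {P Q R : HolTHPair 𝔄} (φ : P ⟶ Q) (ψ : Q ⟶ R) :
    (φ ≫ ψ).base = φ.base ≫ ψ.base := rfl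
/-- The arithmetic part of a composite is the composite map. [cite: MochizukiAbsTopIII2015, Definition 4.1 (ii) p.102] -/
@[simp] theorem comp_toFun {P Q R : HolTHPair 𝔄} (φ : P ⟶ Q) (ψ : Q ⟶ R) (x : P.carrier) :
    (φ ≫ ψ).toFun x = ψ.toFun ⟨φ.toFun x, φ.mem x⟩ := rfl

variable (𝔄) in
/-- **Def 4.1 (iii): the natural functor `𝒞^hol_TH → EA`**, `(𝕏 ↶ M) ↦ 𝕏`.
[cite: MochizukiAbsTopIII2015, Definition 4.1 (iii) p.103] -/
def toEA : HolTHPair 𝔄 ⥤ 𝔄.EA where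
  obj P := P.X
  map φ := φ.base

/-- `(𝕏 ↶ M) ↦ 𝕏` on objects. [cite: MochizukiAbsTopIII2015, Definition 4.1 (iii) p.103] -/
@[simp] theorem toEA_obj (P : HolTHPair 𝔄) : (toEA 𝔄).obj P = P.X := rfl
/-- `(φ_𝕏, φ_M) ↦ φ_𝕏` on morphisms. [cite: MochizukiAbsTopIII2015, Definition 4.1 (iii) p.103] -/
@[simp] theorem toEA_map {P Q : HolTHPair 𝔄} (φ : P ⟶ Q) : (toEA 𝔄).map φ = φ.base := rfl

end HolTHPair

end Literature.AnabelianGeometry.AbsoluteAnabelian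

end
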